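import Summits.BirchSwinnertonDyer.Uniform.UI.O2SigmaNormalisation
import Summits.BirchSwinnertonDyer.BirchSwinnertonDyer.Theorems.ClassRecordThreeRung62310y1HeightEvalFormalLog
import Summits.BirchSwinnertonDyer.BirchSwinnertonDyer.Theorems.ClassRecordThreeRung62310y1HeightEvalSigma
import HarnessLib

/-!
# Crux `SchneiderTamAtThree` (item 19154) — THE HEIGHT IS THE LOGARITHM OF THE NUMERATOR, part 1/4:
# second-order estimates for the series of the transcription at `p = 3`

HONEST FRAMING (cell `bsd-stepL`, seat `bsd-stepL-tam3-p2` g0, WIDTH-LEVER second lane «closed-form Schneider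
local factor at 3»; `--supports stmt-BirchSwinnertonDyer-19154 --as helper`): THEOREMS ONLY, unconditional,
route-independent (no Theses import); 0 definitions, 0 named facts, 0 sorry; nothing here proves the
crux `SchneiderTamAtThree`, Schneider's conjecture or BSD. Objects: ui-o2's `Σ²_E(P) = tateSigmaValueSq`
(`Uniform/UI/O2.lean`), SW's height (4.1) `heightFourOneCoord`, the tree's formal logarithm
`padicFormalLog`, `coshOfSq`, `tateSigmaSq`, `uniformisationScaleSq`.

This file supplies the four RELATIVE second-order estimates behind the main theorem of part 3
(`norm_x_mul_tateSigmaValueSq_sub_one_le`: `‖x(P)·Σ²_E(P) − 1‖₃ ≤ ‖x(P)‖₃⁻¹`):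

* `norm_padicFormalLog_sub_cubic_le_pow_four` — `‖log_W z − (z + ½a₁z² + ⅓(a₁²+a₂)z³)‖₃ ≤ ‖z‖⁴` on
  `‖z‖₃ ≤ 3⁻¹` (lane A's `Rung62310y1.norm_padicFormalLog_sub_cubic_le` has the absolute bound `3⁻⁴`);
* `norm_coshOfSq_sub_quadratic_le`, `norm_two_mul_coshOfSq_sub_one_sub_sub_le` —
  `‖2(ch w − 1) − w − w²/12‖₃ ≤ 9‖w‖³` on `‖w‖₃ ≤ 3⁻²`;
* `norm_pow_three_div_sq_sub_le` — `‖x³/y² − 1 − a₁x/y‖ ≤ ‖x‖⁻¹` on `E₁` (`x z² = 1 − a₁z + O(z²)`);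
* `norm_tateSigmaSq_factor_sub_one_le_mul`, `norm_tprod_tateSigmaSq_factor_sub_one_le_mul` — the
  `q`-product `Π` of `σ_q²` satisfies `‖Π − 1‖ ≤ ‖q‖·‖c − 1‖` (any `p`).

References: [SilvermanAEC2009] IV.1, IV.5–IV.6, VII.2; [SteinWuthrich2013] §4.2; lane A files
`Theorems/ClassRecordThreeRung62310y1HeightEval{FormalLog,Sigma}.lean` (coefficients of `log_W`,
summability of `ch`), ui-o2 `Uniform/UI/O2SigmaNormalisation.lean` (`norm_tprod_sub_one_le`).
-/

noncomputable section

open scoped Classical Nat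
open Filter Topology IsUltrametricDist PowerSeries
open WeierstrassCurve Literature.NumberTheory.EllipticCurves
open Literature.NumberTheory.EllipticCurves.SteinWuthrich2013
open Literature.NumberTheory.EllipticCurves.TateCurve
open Literature.NumberTheory.EllipticCurves.Rank1Residual
open Summit.BirchSwinnertonDyer.Uniform.UI.O2

namespace Summit.BirchSwinnertonDyer.Rank1Residual.X11b.RegMult.HeightLogNumerator

/-- Ultrametric inequality for differences. [folklore] -/
theorem norm_sub_le_max₃ {p : ℕ} [Fact p.Prime] (a b : ℚ_[p]) : ‖a - b‖ ≤ max ‖a‖ ‖b‖ := by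
  rw [sub_eq_add_neg, ← norm_neg b]; exact IsUltrametricDist.norm_add_le_max a (-b)

/-! ### §1 The formal logarithm to third order, RELATIVE error: `‖log z − (z + ½a₁z² + ⅓(a₁²+a₂)z³)‖ ≤ ‖z‖⁴` -/

section FormalLog

variable (V : WeierstrassCurve ℚ_[3]) [V.IsIntegral ℤ_[3]]

/-- `‖1/(n+4)‖₃ · 3⁻ⁿ ≤ 1`, i.e. `‖1/(n+4)‖₃ ≤ 3ⁿ` (`n + 4 ≤ 3ⁿ` for `n ≥ 2`; `4, 5` are units). [folklore] -/
private theorem norm_inv_natCast_add_four_le (n : ℕ) : ‖(((n + 4 : ℕ) : ℚ_[3]))⁻¹‖ ≤ (3 : ℝ) ^ n := by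
  rcases Nat.lt_or_ge n 2 with hn | hn
  · have hunit : ‖(((n + 4 : ℕ) : ℚ_[3]))⁻¹‖ = 1 := by
      rw [norm_inv, Padic.norm_eq_zpow_neg_valuation (by exact_mod_cast (show (n + 4 : ℕ) ≠ 0 by omega)),
        Padic.valuation_natCast, padicValNat.eq_zero_of_not_dvd (by interval_cases n <;> norm_num)]
      simp
    rw [hunit]
    exact one_le_pow₀ (by norm_num)
  · have hm : ‖(((n + 4 : ℕ) : ℚ_[3]))⁻¹‖ ≤ ((n + 4 : ℕ) : ℝ) := padic_norm_inv_natCast_le (n + 4)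
    refine hm.trans ?_
    have key : ∀ k : ℕ, ((k + 2 + 4 : ℕ) : ℝ) ≤ (3 : ℝ) ^ (k + 2) := by
      intro k
      induction k with
      | zero => norm_num
      | succ j ih =>
        have : ((j + 1 + 2 + 4 : ℕ) : ℝ) = ((j + 2 + 4 : ℕ) : ℝ) + 1 := by push_cast; ring
        rw [this, show j + 1 + 2 = (j + 2) + 1 by ring, pow_succ]
        nlinarith [ih, show (1 : ℝ) ≤ (3 : ℝ) ^ (j + 2) from one_le_pow₀ (by norm_num)]
    obtain ⟨k, rfl⟩ : ∃ k, n = k + 2 := ⟨n - 2, by omega⟩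
    exact key k

/-- The terms of degree `n + 4` of `log_W(z)` have norm `≤ ‖z‖⁴` when `‖z‖₃ ≤ 3⁻¹`
(`‖1/(n+4)‖₃ ≤ 3ⁿ` and `‖z‖ⁿ ≤ 3⁻ⁿ`). [cite: SilvermanAEC2009, IV.6.3] -/
private theorem norm_formalLog_term_le_pow_four {z : ℚ_[3]} (hz : ‖z‖ ≤ 1 / 3) (n : ℕ) :
    ‖coeff (n + 4) V.formalLog * z ^ (n + 4)‖ ≤ ‖z‖ ^ 4 := by
  rw [norm_mul, norm_pow]
  have hc := Rung62310y1.norm_coeff_formalLog_le_norm_inv V (n + 2)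
  rw [show n + 2 + 2 = n + 4 by ring] at hc
  have hz0 : 0 ≤ ‖z‖ := norm_nonneg z
  calc ‖coeff (n + 4) V.formalLog‖ * ‖z‖ ^ (n + 4) ≤ (3 : ℝ) ^ n * ‖z‖ ^ (n + 4) := by
        gcongr; exact hc.trans (norm_inv_natCast_add_four_le n)
    _ = ((3 : ℝ) ^ n * ‖z‖ ^ n) * ‖z‖ ^ 4 := by ring
    _ ≤ ((3 : ℝ) ^ n * (1 / 3 : ℝ) ^ n) * ‖z‖ ^ 4 := by gcongr
    _ = ‖z‖ ^ 4 := by rw [← mul_pow]; norm_num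

/-- **`log_W(z) = z + (a₁/2)z² + ((a₁²+a₂)/3)z³ + O(‖z‖⁴)` on `‖z‖₃ ≤ 3⁻¹`** for a `3`-integral
equation over `ℚ₃` — the RELATIVE form of lane A's `Rung62310y1.norm_padicFormalLog_sub_cubic_le`
(there: absolute error `3⁻⁴`). [cite: SilvermanAEC2009, IV.5.5, IV.6.4] -/
theorem norm_padicFormalLog_sub_cubic_le_pow_four {z : ℚ_[3]} (hz : ‖z‖ ≤ 1 / 3) :
    ‖V.padicFormalLog z - (z + (2 : ℚ_[3])⁻¹ * V.a₁ * z ^ 2 + (3 : ℚ_[3])⁻¹ * (V.a₁ ^ 2 + V.a₂) * z ^ 3)‖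
      ≤ ‖z‖ ^ 4 := by
  have hs := V.summable_formalLog_of_isIntegral z (hz.trans_lt (by norm_num))
  have hsplit := hs.sum_add_tsum_nat_add 4
  have h0 : coeff 0 V.formalLog = 0 := by rw [coeff_zero_eq_constantCoeff]; exact V.constantCoeff_formalLog
  have h2 : coeff 2 V.formalLog = (2 : ℚ_[3])⁻¹ * V.a₁ := by
    rw [(Rung62310y1.coeff_two_formalLog V), eq_ratCast]; push_cast; ring
  have h3 : coeff 3 V.formalLog = (3 : ℚ_[3])⁻¹ * (V.a₁ ^ 2 + V.a₂) := by
    rw [(Rung62310y1.coeff_three_formalLog V), eq_ratCast]; push_cast; ring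
  have hfour : ∑ i ∈ Finset.range 4, coeff i V.formalLog * z ^ i =
      z + (2 : ℚ_[3])⁻¹ * V.a₁ * z ^ 2 + (3 : ℚ_[3])⁻¹ * (V.a₁ ^ 2 + V.a₂) * z ^ 3 := by
    simp only [Finset.sum_range_succ, Finset.sum_range_zero, h0, V.coeff_one_formalLog, h2, h3]
    ring
  rw [WeierstrassCurve.padicFormalLog, ← hsplit, hfour, add_sub_cancel_left]
  exact IsUltrametricDist.norm_tsum_le_of_forall_le_of_nonneg (by positivity) fun n ↦
    norm_formalLog_term_le_pow_four V hz n

end FormalLog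

/-! ### §2 The `cosh` series to second order, RELATIVE error: `‖2(ch w − 1) − w − w²/12‖ ≤ 9‖w‖³` -/

/-- **Legendre at `p = 3`**: `‖1/(2n)!‖₃ ≤ 3ⁿ`. [folklore] -/
private theorem norm_inv_two_mul_factorial_le (n : ℕ) :
    ‖(((2 * n).factorial : ℕ) : ℚ_[3])⁻¹‖ ≤ (3 : ℝ) ^ n := by
  -- adapted from lane A's `Rung62310y1HeightEvalSigma` (private there)
  have hf : ((2 * n).factorial : ℕ) ≠ 0 := Nat.factorial_ne_zero _
  rw [norm_inv, Padic.norm_eq_zpow_neg_valuation (by exact_mod_cast hf), Padic.valuation_natCast, zpow_neg,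
    inv_inv, zpow_natCast]
  have hv : padicValNat 3 (2 * n).factorial ≤ n := by
    have h := sub_one_mul_padicValNat_factorial (p := 3) (2 * n)
    have hs : (3 - 1) * padicValNat 3 (2 * n).factorial ≤ 2 * n := by rw [h]; exact Nat.sub_le _ _
    omega
  exact_mod_cast Nat.pow_le_pow_right (by norm_num) hv

/-- **`‖ch(w) − (1 + w/2 + w²/24)‖₃ ≤ 9‖w‖³` for `‖w‖₃ ≤ 3⁻²`** (relative form of lane A's
`Rung62310y1.norm_coshOfSq_sub_le`): the cubic term has norm `‖w‖³·‖1/720‖₃ = 9‖w‖³` and every later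
term `‖wⁿ/(2n)!‖ ≤ 3ⁿ‖w‖ⁿ ≤ 9‖w‖³·(3‖w‖)^{n−3}·3 ≤ 9‖w‖³`. [folklore] -/
theorem norm_coshOfSq_sub_quadratic_le {w : ℚ_[3]} (hw : ‖w‖ ≤ 1 / 9) :
    ‖coshOfSq w - (1 + w / 2 + w ^ 2 / 24)‖ ≤ 9 * ‖w‖ ^ 3 := by
  have hs := Rung62310y1.summable_coshOfSq_term hw
  have hsplit := hs.sum_add_tsum_nat_add 3
  have hdef : coshOfSq w = ∑' n : ℕ, w ^ n / (((2 * n).factorial : ℕ) : ℚ_[3]) := by rw [coshOfSq]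
  have hthree : ∑ i ∈ Finset.range 3, w ^ i / (((2 * i).factorial : ℕ) : ℚ_[3]) = 1 + w / 2 + w ^ 2 / 24 := by
    simp only [Finset.sum_range_succ, Finset.sum_range_zero]
    norm_num [Nat.factorial]
  rw [hdef, ← hsplit, hthree, add_sub_cancel_left]
  refine IsUltrametricDist.norm_tsum_le_of_forall_le_of_nonneg (by positivity) fun n ↦ ?_
  rw [div_eq_mul_inv, norm_mul, norm_pow]
  have hw0 : 0 ≤ ‖w‖ := norm_nonneg w
  cases n with
  | zero =>
    -- the cubic term: `‖1/720‖₃ = 9` (adapted from lane A's `Rung62310y1.norm_coshOfSq_sub_le`)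
    have hf : (2 * (0 + 3)).factorial = 720 := by decide
    have h720n : ‖((720 : ℕ) : ℚ_[3])⁻¹‖ = 9 := by
      rw [norm_inv, Padic.norm_eq_zpow_neg_valuation (by norm_num), Padic.valuation_natCast]
      have : padicValNat 3 720 = 2 := by
        have h1 : 2 ≤ padicValNat 3 720 := (padicValNat_dvd_iff_le (by norm_num)).mp (by norm_num)
        have h2 : ¬ 3 ≤ padicValNat 3 720 := fun h => by
          have := (padicValNat_dvd_iff_le (p := 3) (n := 3) (by norm_num : (720 : ℕ) ≠ 0)).mpr h
          norm_num at this
        omega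
      rw [this]; norm_num
    rw [hf, h720n, show 0 + 3 = 3 from rfl, mul_comm]
  | succ k =>
    have hfac := norm_inv_two_mul_factorial_le (k + 1 + 3)
    calc ‖w‖ ^ (k + 1 + 3) * ‖((((2 * (k + 1 + 3)).factorial : ℕ) : ℚ_[3]))⁻¹‖
        ≤ ‖w‖ ^ (k + 1 + 3) * (3 : ℝ) ^ (k + 1 + 3) := by gcongr
      _ = (9 * ‖w‖ ^ 3) * ((3 * ‖w‖) ^ k * (9 * ‖w‖)) := by ring
      _ ≤ (9 * ‖w‖ ^ 3) * ((3 * (1 / 9)) ^ k * (9 * (1 / 9))) := by gcongr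
      _ ≤ (9 * ‖w‖ ^ 3) * 1 := by
          refine mul_le_mul_of_nonneg_left ?_ (by positivity)
          calc (3 * (1 / 9) : ℝ) ^ k * (9 * (1 / 9)) ≤ 1 ^ k * 1 := by gcongr <;> norm_num
            _ = 1 := by norm_num
      _ = 9 * ‖w‖ ^ 3 := mul_one _

/-- **`‖2(ch(w) − 1) − w − w²/12‖₃ ≤ 9‖w‖³` for `‖w‖₃ ≤ 3⁻²`** (`‖2‖₃ = 1`). [folklore] -/
theorem norm_two_mul_coshOfSq_sub_one_sub_sub_le {w : ℚ_[3]} (hw : ‖w‖ ≤ 1 / 9) :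
    ‖2 * (coshOfSq w - 1) - w - w ^ 2 / 12‖ ≤ 9 * ‖w‖ ^ 3 := by
  have h2 : ‖(2 : ℚ_[3])‖ = 1 := by
    simpa using Padic.norm_natCast_eq_one_iff.mpr (show Nat.Coprime 3 2 by decide)
  have e : 2 * (coshOfSq w - 1) - w - w ^ 2 / 12 = 2 * (coshOfSq w - (1 + w / 2 + w ^ 2 / 24)) := by ring
  rw [e, norm_mul, h2, one_mul]
  exact norm_coshOfSq_sub_quadratic_le hw

/-! ### §3 The equation to second order: `x³/y² = 1 + a₁x/y + O(‖x‖⁻¹)` on `E₁` -/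

/-- **`‖x³/y² − 1 − a₁·x/y‖ ≤ ‖x‖⁻¹` for a point `(x, y)` with `‖x‖ > 1` of a `3`-integral Weierstrass
equation** (`x³ − y² − a₁xy = a₃y − a₂x² − a₄x − a₆`, each term of norm `≤ ‖x‖² = ‖y‖²‖x‖⁻¹`): the
second-order form of ui-o2's `norm_pow_three_div_sq_sub_one_lt_one` (`x·z² = 1 − a₁z + O(z²)`).
[cite: SilvermanAEC2009, IV.1 and VII.2.2] -/
theorem norm_pow_three_div_sq_sub_le {V : WeierstrassCurve ℚ_[3]} [V.IsIntegral ℤ_[3]] {x y : ℚ_[3]}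
    (heq : V.toAffine.Equation x y) (hx : 1 < ‖x‖) :
    ‖x ^ 3 / y ^ 2 - 1 - V.a₁ * (x / y)‖ ≤ ‖x‖⁻¹ := by
  obtain ⟨h₁, h₂, h₃, h₄, h₆⟩ := V.norm_coeffs_le_one
  obtain ⟨hsq, hxy⟩ := V.norm_sq_eq_norm_cube heq hx
  rw [Affine.equation_iff] at heq
  have hx0 : 0 < ‖x‖ := one_pos.trans hx
  have hy1 : 1 < ‖y‖ := hx.trans hxy
  have hy0 : 0 < ‖y‖ := one_pos.trans hy1
  have hy0' : y ≠ 0 := norm_pos_iff.mp hy0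
  have hy2 : y ^ 2 ≠ 0 := pow_ne_zero 2 hy0'
  have hnum : x ^ 3 - y ^ 2 - V.a₁ * x * y = V.a₃ * y + (-(V.a₂ * x ^ 2) + (-(V.a₄ * x) + -V.a₆)) := by
    linear_combination -heq
  have e : x ^ 3 / y ^ 2 - 1 - V.a₁ * (x / y) =
      (V.a₃ * y + (-(V.a₂ * x ^ 2) + (-(V.a₄ * x) + -V.a₆))) / y ^ 2 := by
    rw [← hnum, eq_div_iff hy2]
    field_simp
  rw [e, norm_div, norm_pow, div_le_iff₀ (pow_pos hy0 2)]
  -- `‖x‖⁻¹ · ‖y‖² = ‖x‖²`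
  have hrhs : ‖x‖⁻¹ * ‖y‖ ^ 2 = ‖x‖ ^ 2 := by
    rw [hsq, pow_succ', ← mul_assoc, inv_mul_cancel₀ hx0.ne', one_mul]
  rw [hrhs]
  have hx1 : 1 ≤ ‖x‖ := hx.le
  have hxx : ‖x‖ ≤ ‖x‖ ^ 2 := by nlinarith
  have hyx2 : ‖y‖ ≤ ‖x‖ ^ 2 := by nlinarith [hsq, norm_nonneg y]
  refine (norm_add_le_max _ _).trans (max_le ?_ ((norm_add_le_max _ _).trans (max_le ?_
    ((norm_add_le_max _ _).trans (max_le ?_ ?_)))))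
  · rw [norm_mul]
    calc ‖V.a₃‖ * ‖y‖ ≤ 1 * ‖y‖ := by gcongr
      _ = ‖y‖ := one_mul _
      _ ≤ ‖x‖ ^ 2 := hyx2
  · rw [norm_neg, norm_mul, norm_pow]
    calc ‖V.a₂‖ * ‖x‖ ^ 2 ≤ 1 * ‖x‖ ^ 2 := by gcongr
      _ = ‖x‖ ^ 2 := one_mul _
  · rw [norm_neg, norm_mul]
    calc ‖V.a₄‖ * ‖x‖ ≤ 1 * ‖x‖ := by gcongr
      _ = ‖x‖ := one_mul _
      _ ≤ ‖x‖ ^ 2 := hxx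
  · rw [norm_neg]
    calc ‖V.a₆‖ ≤ 1 := h₆
      _ ≤ ‖x‖ := hx1
      _ ≤ ‖x‖ ^ 2 := hxx

/-! ### §4 The `q`-product of `σ_q²` is `1 + O(q·(c − 1))` -/

/-- Each factor `(1 − 2qⁿ⁺¹c + q^{2(n+1)})²/(1 − qⁿ⁺¹)⁴` of the `q`-product in `σ_q(u)²` is
`1 + O(q·(c−1))`: `‖factor − 1‖ ≤ ‖q‖·‖c − 1‖` for `‖q‖ < 1`, `‖c‖ ≤ 1` (numerator
`(1−qⁿ⁺¹)² − 2qⁿ⁺¹(c−1)`). [cite: SteinWuthrich2013, §4.2 (p. 15)] -/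
theorem norm_tateSigmaSq_factor_sub_one_le_mul {p : ℕ} [Fact p.Prime] {q c : ℚ_[p]} (hq : ‖q‖ < 1)
    (hc : ‖c‖ ≤ 1) (n : ℕ) :
    ‖(1 - 2 * q ^ (n + 1) * c + q ^ (2 * (n + 1))) ^ 2 / (1 - q ^ (n + 1)) ^ 4 - 1‖ ≤ ‖q‖ * ‖c - 1‖ := by
  have hqn : ‖q ^ (n + 1)‖ < 1 := by
    rw [norm_pow]; exact pow_lt_one₀ (norm_nonneg _) hq (Nat.succ_ne_zero n)
  have hqn' : ‖q ^ (n + 1)‖ ≤ ‖q‖ := by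
    rw [norm_pow, pow_succ]
    exact mul_le_of_le_one_left (norm_nonneg _) (pow_le_one₀ (norm_nonneg _) hq.le)
  have h2 : ‖(2 : ℚ_[p])‖ ≤ 1 := by
    have h : ((2 : ℤ) : ℚ_[p]) = 2 := by norm_cast
    rw [← h]; exact Padic.norm_int_le_one 2
  set Q := q ^ (n + 1) with hQ
  have hD1 : ‖(1 - Q)‖ = 1 := norm_one_sub_eq_one hqn
  have hD : (1 - Q) ^ 4 ≠ 0 := by
    apply pow_ne_zero; intro h; rw [h, norm_zero] at hD1; exact zero_ne_one hD1
  have hq2 : q ^ (2 * (n + 1)) = Q ^ 2 := by rw [hQ, ← pow_mul, mul_comm]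
  -- `factor − 1 = (N − D')(N + D')/D'²` with `N − D' = −2Q(c−1)`
  have e : (1 - 2 * Q * c + q ^ (2 * (n + 1))) ^ 2 / (1 - Q) ^ 4 - 1 =
      (-(2 * Q * (c - 1))) * ((1 - 2 * Q * c + Q ^ 2) + (1 - Q) ^ 2) / (1 - Q) ^ 4 := by
    rw [hq2, div_sub_one hD]
    congr 1
    ring
  rw [e, norm_div, norm_mul, norm_pow, hD1, one_pow, div_one, norm_neg]
  have hQ1 : ‖Q‖ ≤ 1 := hqn.le
  have h2Qc : ‖2 * Q * c‖ ≤ 1 := by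
    rw [norm_mul, norm_mul]
    calc ‖(2 : ℚ_[p])‖ * ‖Q‖ * ‖c‖ ≤ 1 * 1 * 1 := by gcongr
      _ = 1 := by norm_num
  have hQ2 : ‖Q ^ 2‖ ≤ 1 := by rw [norm_pow]; exact pow_le_one₀ (norm_nonneg _) hqn.le
  have hN1 : ‖1 - 2 * Q * c + Q ^ 2‖ ≤ 1 :=
    (norm_add_le_max _ _).trans (max_le ((norm_sub_le_max₃ _ _).trans (max_le (by simp) h2Qc)) hQ2)
  have hN : ‖(1 - 2 * Q * c + Q ^ 2) + (1 - Q) ^ 2‖ ≤ 1 :=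
    (norm_add_le_max _ _).trans (max_le hN1 (by rw [norm_pow, hD1, one_pow]))
  calc ‖2 * Q * (c - 1)‖ * ‖(1 - 2 * Q * c + Q ^ 2) + (1 - Q) ^ 2‖
      ≤ ‖2 * Q * (c - 1)‖ * 1 := by gcongr
    _ = ‖(2 : ℚ_[p])‖ * ‖Q‖ * ‖c - 1‖ := by rw [mul_one, norm_mul, norm_mul]
    _ ≤ 1 * ‖q‖ * ‖c - 1‖ := by gcongr
    _ = ‖q‖ * ‖c - 1‖ := by rw [one_mul]

/-- **The `q`-product `Π` of `σ_q(u)²` is `1 + O(q·(c − 1))`**: `‖Π − 1‖ ≤ ‖q‖·‖c − 1‖` (ui-o2's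
`norm_tprod_sub_one_le` with the factor bound above). [cite: SteinWuthrich2013, §4.2 (p. 15)] -/
theorem norm_tprod_tateSigmaSq_factor_sub_one_le_mul {p : ℕ} [Fact p.Prime] {q c : ℚ_[p]}
    (hq : ‖q‖ < 1) (hc : ‖c‖ ≤ 1) :
    ‖(∏' n : ℕ, (1 - 2 * q ^ (n + 1) * c + q ^ (2 * (n + 1))) ^ 2 / (1 - q ^ (n + 1)) ^ 4) - 1‖
      ≤ ‖q‖ * ‖c - 1‖ := by
  have hc1 : ‖c - 1‖ ≤ 1 := (norm_sub_le_max₃ _ _).trans (max_le hc (by simp))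
  have hq1 : ‖q‖ ≤ 1 := hq.le
  refine norm_tprod_sub_one_le (by positivity) ?_ fun n => norm_tateSigmaSq_factor_sub_one_le_mul hq hc n
  calc ‖q‖ * ‖c - 1‖ ≤ 1 * 1 := by gcongr
    _ = 1 := one_mul _


end Summit.BirchSwinnertonDyer.Rank1Residual.X11b.RegMult.HeightLogNumerator

end
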